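import Literature.NumberTheory.Transcendental.KZCubeCorner
import Summits.KontsevichZagierPeriods.KontsevichZagierPeriods.Theorems.FurushoPentagonPentagonInKZSimplexToCube
import Summits.KontsevichZagierPeriods.KontsevichZagierPeriods.Theorems.FurushoPentagonPentagonInKZCornersCubicalTransport

/-!
# `PentagonInKZ`: the bridge from simplex families to cube series (corner principle, aux 1)

Helper for the registered stub `stub_cornerPrinciple` of the crux `FurushoPentagon.PentagonInKZ`
(stmt-KontsevichZagierPeriods-11348; registered helper `cornerBridge_evalW`): word by word
(`chi_of_simplex_eq`, via the cubical chart `simplexToCube` for live words and the vanishing of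
dead words) and at the level of the degree-`n` parts of end-regularised series (`evalW_bridge`:
injective letter map, dead letters outside its image), the simplex families of a chart direction
realise `c̄` times the cube series of `Literature/…/KZCube*`.
[cite: KontsevichZagier2001, §1.2]; [cite: IharaKanekoZagier2006, §3]
-/

noncomputable section

open MeasureTheory Set MvPolynomial

namespace Summit.KontsevichZagierPeriods.FurushoPentagon.PentagonInKZ

open Literature.NumberTheory.Transcendental Literature.NumberTheory.Transcendental.KZ Literature.NumberTheory.Transcendental.KZ.Cube

/-! ## The bridge: simplex families of a corner chart versus the cube series (Summit side) -/

section Bridge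

open Shuffle NCSeries

variable {ι : Type} {mm : ℕ}
variable {R : Type} [CommRing R] [Algebra ℚ R] {χ : KZ.FormalRep →+ R} (hrel : ∀ c ∈ KZ.relations, χ c = 0)

include hrel in
/-- **The word-by-word bridge.** For rider-free direction data `Δ` (bound `c̄ > 0`), a simplex
family `I` over an alphabet `L` with letter densities `dens`, and a letter map `e : Option ι → L`
reading the axis as the density `1/s` and the divisor `ℓ` as `N_ℓ/(N_ℓ s + M_ℓ)`, the class of the
simplex representation of `v.map e` is `c̄` times the cube coefficient of `v`
(`v` non-empty, not ending in the axis).  Live words: the cubical chart `simplexToCube`; dead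
words: both sides vanish. [cite: KontsevichZagier2001, §1.2] -/
theorem chi_of_simplex_eq (Δ : DirData ι (0 + 0)) (hc : 0 < Δ.c) {L : Type} (e : Option ι → L) (dens : L → ℝ → ℝ)
    (hnone : ∀ s : ℝ, 0 < s → s < (Δ.c : ℝ) → dens (e none) s = 1 / s)
    (hsome : ∀ (ℓ : ι) (s : ℝ), 0 < s → s < (Δ.c : ℝ) → dens (e (some ℓ)) s = (cval (Δ.N ℓ) : ℝ) / ((cval (Δ.N ℓ) : ℝ) * s + (cval (Δ.M ℓ) : ℝ)))
    (v : List (Option ι)) (hv : v ≠ []) (hvl : v.getLast? ≠ some none)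
    (I : KZ.IntegralRep (v.map e).length)
    (hI : I.domain = {t | (∀ i, 0 < t i ∧ t i < (Δ.c : ℝ)) ∧ StrictAnti t} ∧
      Set.EqOn I.integrand (fun t => ∏ i, dens ((v.map e).get i) (t i)) I.domain) :
    χ (KZ.of I) = algebraMap ℚ R Δ.c * zcoef (χ := χ) (m := 0) (k := 0) Δ.c Δ.hc Δ.d Δ.hd (RFun.const 1) 1 isScale_one0 v := by
  by_cases hdead : ∃ ℓ, some ℓ ∈ v ∧ cval (Δ.N ℓ) = 0
  · obtain ⟨ℓ, hℓ, hN⟩ := hdead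
    rw [Δ.zcoef_eq_zero_of_dead hrel v hℓ hN, mul_zero]
    refine CornersCubical.chi_eq_zero_of_dead χ hrel (Δ.c : ℝ) dens I hI
      (a := e (some ℓ)) (List.mem_map.mpr ⟨_, hℓ, rfl⟩) fun s hs hs' => ?_
    rw [hsome ℓ s hs hs', hN, Rat.cast_zero, zero_div]
  push Not at hdead
  have hc' : (0 : ℝ) < Δ.c := by exact_mod_cast hc
  -- lengths and the reindexing
  have hlen : v.length = (v.map e).length := (List.length_map _).symm
  have hget : ∀ i : Fin (v.map e).length, (v.map e).get i = e (v.get (Fin.cast hlen.symm i)) := fun i => by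
    simp [List.getElem_map]
  -- the cube side as a representation in dimension `(v.map e).length`
  set F : RFun (v.length + (0 + 0)) :=
    (RFun.const Δ.c).mul (famTerm (m := 0) (k := 0) (RFun.const 1) (Zw Δ.c Δ.hc Δ.d Δ.hd v) 1 isScale_one0) with hF
  have hmove := simplexToCube (v.map e).length Δ.c
    (fun i => Δ.poleQ (v.get (Fin.cast hlen.symm i))) I (F.rename (finCongr hlen)).rep hc hI.1 ?_ rfl ?_
  · -- conclusion: `χ[I] = χ[F] = c̄ · zcoef`
    have h := hrel _ hmove
    rw [map_sub, sub_eq_zero] at h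
    rw [h, show χ (KZ.of (F.rename (finCongr hlen)).rep) = (F.rename (finCongr hlen)).chi χ from rfl, RFun.chi_rename hrel, hF,
      RFun.chi_const_mul hrel]
    rfl
  · -- the simplex integrand has simple poles at the rational poles
    intro t ht
    rw [hI.2 ht]
    rw [hI.1] at ht
    refine Finset.prod_congr rfl fun i _ => ?_
    have hti := ht.1 i
    rw [hget i]
    cases hvi : v.get (Fin.cast hlen.symm i) with
    | none => rw [hnone _ hti.1 hti.2]; simp [DirData.poleQ]
    | some ℓ =>
      have hN : (cval (Δ.N ℓ) : ℝ) ≠ 0 := by exact_mod_cast hdead ℓ (hvi ▸ List.get_mem _ _)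
      rw [hsome ℓ _ hti.1 hti.2]
      simp only [DirData.poleQ, Option.elim]
      push_cast
      rw [neg_div, sub_neg_eq_add, add_div' _ _ _ hN, one_div_div]
      congr 1; ring
  · -- the cube integrand is `c̄ · Z_v` at scale `1`, in simplex form
    intro x hx
    have hxmem : (x ∘ (finCongr hlen)) ∈ KZ.cube (v.length + (0 + 0)) := fun j => ⟨(hx _).1.le, (hx _).2.le⟩
    rw [RFun.rep_integrand, RFun.fn_rename, hF, RFun.fn_mul, RFun.fn_const, fn_famTerm, RFun.fn_const, Rat.cast_one, one_mul]
    set z := famPt (m := 0) (k := 0) v.length (1 : MvPolynomial (Fin (0 + 0)) ℚ) (x ∘ (finCongr hlen)) with hz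
    have hzmem : z ∈ KZ.cube ((v.length + 0) + 1) := famPt_mem isScale_one0 hxmem
    have hscale : wScale (n := v.length) (m := 0) z = 1 := by rw [hz, wScale_famPt, map_one]
    have hwX : wX (n := v.length) (m := 0) z = fun j => x (Fin.cast hlen j) := by
      funext j; rw [hz, wX_famPt]; rfl
    have hxpos : ∀ j, 0 < wX (n := v.length) (m := 0) z j := fun j => by rw [hwX]; exact (hx _).1
    have key := Δ.scale_mul_fn_Zw v hv hvl z hzmem hxpos (by rw [hscale]; exact one_pos) hc
      (fun ℓ hℓ => by rw [aeval_eq_cval]; exact_mod_cast hdead ℓ hℓ)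
    rw [hscale, mul_one] at key
    rw [key]
    refine Fintype.prod_equiv (finCongr hlen) _ _ fun i => ?_
    rw [hwX, pprodLt_cast hlen, pprodLe_cast hlen, Δ.poleR_eq]
    rfl

include hrel in
/-- **The series-level bridge.** For an injective letter map `e : Option ι → L` whose image misses
only DEAD letters (density `0` on `(0,c̄)`), the degree-`n` part (`n > 0`) of the end-regularised
series of the simplex family, read at residues `Z`, is `c̄` times the degree-`n` part of the cube
series read at the residues `Z ∘ e`. [cite: IharaKanekoZagier2006, §3] -/
theorem evalW_bridge (Δ : DirData ι (0 + 0)) (hc : 0 < Δ.c) {L : Type} [Fintype L] [DecidableEq L] [Fintype ι] [DecidableEq ι]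
    (e : Option ι → L) (he : Function.Injective e) (dens : L → ℝ → ℝ)
    (hnone : ∀ s : ℝ, 0 < s → s < (Δ.c : ℝ) → dens (e none) s = 1 / s)
    (hsome : ∀ (ℓ : ι) (s : ℝ), 0 < s → s < (Δ.c : ℝ) → dens (e (some ℓ)) s = (cval (Δ.N ℓ) : ℝ) / ((cval (Δ.N ℓ) : ℝ) * s + (cval (Δ.M ℓ) : ℝ)))
    (hout : ∀ b : L, b ∉ Set.range e → ∀ s : ℝ, 0 < s → s < (Δ.c : ℝ) → dens b s = 0)
    (I : (w : List L) → KZ.IntegralRep w.length)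
    (hI : ∀ w : List L, w.getLast? ≠ some (e none) → (I w).domain = {t | (∀ i, 0 < t i ∧ t i < (Δ.c : ℝ)) ∧ StrictAnti t} ∧
      Set.EqOn (I w).integrand (fun t => ∏ i, dens (w.get i) (t i)) (I w).domain)
    (P : NCSeries L R) (hP : ∀ W, P W = if W = [] then 1 else pair (fun w => χ (KZ.of (I w))) (regEnd (e none) W))
    {A : Type} [Ring A] [Algebra R A] (Z : L → A) {n : ℕ} (hn : 0 < n) :
    NCSeries.evalW n Z P = algebraMap ℚ R Δ.c • ZS (χ := χ) (m := 0) (k := 0) Δ.c Δ.hc Δ.d Δ.hd n (fun a => Z (e a)) none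
      (RFun.const 1) 1 isScale_one0 := by
  classical
  have hn' : ∀ (f : Fin n → L), List.ofFn f ≠ [] := fun f h => by
    have := congrArg List.length h; simp at this; omega
  -- words with a letter outside the image of `e` contribute nothing
  have hdeadW : ∀ f : Fin n → L, (∃ i, f i ∉ Set.range e) → P (List.ofFn f) = 0 := by
    rintro f ⟨i, hi⟩
    rw [hP, if_neg (hn' f)]
    have hzero : ∀ u ∈ (regEnd (e none) (List.ofFn f)).support, χ (KZ.of (I u)) = (fun _ => (0 : R)) u := by
      intro u hu
      have hmem : f i ∈ u := mem_of_mem_support_regEnd _ _ hu (List.mem_ofFn.mpr ⟨i, rfl⟩)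
      exact CornersCubical.chi_eq_zero_of_dead χ hrel (Δ.c : ℝ) dens (I u)
        (hI u (getLast?_ne_of_mem_support_regEnd _ _ hu)) hmem (hout _ hi)
    rw [pair_congr hzero]
    simp [pair]
  -- the live words are the `e`-images, word by word `c̄` times the cube coefficient
  have hliveW : ∀ g : Fin n → Option ι, P (List.ofFn fun i => e (g i)) =
      algebraMap ℚ R Δ.c * Zser (χ := χ) (m := 0) (k := 0) Δ.c Δ.hc Δ.d Δ.hd none (RFun.const 1) 1 isScale_one0 (List.ofFn g) := by
    intro g
    have hW : List.ofFn g ≠ [] := fun h => by have := congrArg List.length h; simp at this; omega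
    rw [hP, if_neg (hn' _), Zser, if_neg hW, show (List.ofFn fun i => e (g i)) = (List.ofFn g).map e from List.map_ofFn.symm,
      CornersCubical.regEnd_map_of_fibre e none (fun a h => he h),
      pair_mapDomain', ← pair_mul_left]
    refine pair_congr fun u hu => ?_
    have hu0 : u ≠ [] := by
      intro h
      have := mem_of_mem_support_regEnd _ _ hu (List.mem_ofFn.mpr ⟨⟨0, hn⟩, rfl⟩)
      rw [h] at this; simp at this
    have hul : u.getLast? ≠ some none := getLast?_ne_of_mem_support_regEnd _ _ hu
    have hul' : (u.map e).getLast? ≠ some (e none) := by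
      rw [List.getLast?_map]; intro h
      cases hu' : u.getLast? with
      | none => rw [hu'] at h; simp at h
      | some a => rw [hu'] at h; simp only [Option.map_some, Option.some.injEq] at h; exact hul (by rw [hu', he h])
    exact chi_of_simplex_eq hrel Δ hc e dens hnone hsome u hu0 hul (I (u.map e)) (hI _ hul')
  -- reorganise the sum over words of `L`
  rw [NCSeries.evalW, ZS, NCSeries.evalW, Finset.smul_sum]
  have himage : ∀ f : Fin n → L, f ∉ Finset.univ.image (fun (g : Fin n → Option ι) (i : Fin n) => e (g i)) →
      P (List.ofFn f) • ((List.ofFn f).map Z).prod = 0 := by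
    intro f hf
    rw [hdeadW f ?_, zero_smul]
    by_contra hall
    push Not at hall
    apply hf
    choose g hg using fun i => hall i
    exact Finset.mem_image.mpr ⟨g, Finset.mem_univ _, funext hg⟩
  rw [← Finset.sum_subset (Finset.subset_univ (Finset.univ.image fun (g : Fin n → Option ι) (i : Fin n) => e (g i)))
    fun f _ hf => himage f hf]
  have hinj : ∀ g ∈ (Finset.univ : Finset (Fin n → Option ι)), ∀ g' ∈ (Finset.univ : Finset (Fin n → Option ι)),
      (fun i => e (g i)) = (fun i => e (g' i)) → g = g' :=
    fun g _ g' _ h => funext fun i => he (congrFun h i)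
  rw [Finset.sum_image hinj]
  refine Finset.sum_congr rfl fun g _ => ?_
  rw [hliveW g, mul_smul, List.map_ofFn, List.map_ofFn]
  rfl

/-- **Registered form of the series-level bridge** (`evalW_bridge`, closed statement). [cite: IharaKanekoZagier2006, §3] -/
theorem cornerBridge_evalW : ∀ (R : Type) [CommRing R] [Algebra ℚ R] (χ : KZ.FormalRep →+ R), (∀ c ∈ KZ.relations, χ c = 0) → ∀ (ι : Type) [Fintype ι] [DecidableEq ι] (Δ : KZ.Cube.DirData ι (0 + 0)), 0 < Δ.c → ∀ (L : Type) [Fintype L] [DecidableEq L] (e : Option ι → L), Function.Injective e → ∀ (dens : L → ℝ → ℝ), (∀ s : ℝ, 0 < s → s < (Δ.c : ℝ) → dens (e none) s = 1 / s) → (∀ (ℓ : ι) (s : ℝ), 0 < s → s < (Δ.c : ℝ) → dens (e (some ℓ)) s = (KZ.Cube.cval (Δ.N ℓ) : ℝ) / ((KZ.Cube.cval (Δ.N ℓ) : ℝ) * s + (KZ.Cube.cval (Δ.M ℓ) : ℝ))) → (∀ b : L, b ∉ Set.range e → ∀ s : ℝ, 0 < s → s < (Δ.c : ℝ) → dens b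 s = 0) → ∀ (I : (w : List L) → KZ.IntegralRep w.length), (∀ w : List L, w.getLast? ≠ some (e none) → (I w).domain = {t | (∀ i, 0 < t i ∧ t i < (Δ.c : ℝ)) ∧ StrictAnti t} ∧ Set.EqOn (I w).integrand (fun t => ∏ i, dens (w.get i) (t i)) (I w).domain) → ∀ (P : NCSeries L R), (∀ W, P W = if W = [] then 1 else Shuffle.pair (fun w => χ (KZ.of (I w))) (Shuffle.regEnd (e none) W)) → ∀ (A : Type) [Ring A] [Algebra R A] (Z : L → A) (n : ℕ), 0 < n → NCSeries.evalW n Z P = algebraMap ℚ R Δ.c • KZ.Cube.ZS (χ := χ) (m := 0) (k := 0) Δ.c Δ.hc Δ.d Δ.hd n (fun a => Z (e a)) none (KZ.RFun.const 1) 1 KZ.Cube.isScale_one0 := by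
  intro R _ _ χ hrel ι _ _ Δ hc L _ _ e he dens hnone hsome hout I hI P hP A _ _ Z n hn
  exact evalW_bridge hrel Δ hc e he dens hnone hsome hout I hI P hP Z hn

end Bridge

end Summit.KontsevichZagierPeriods.FurushoPentagon.PentagonInKZ
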